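import Literature.MathematicalPhysics.QuantumFieldTheory.Balaban1983to89.B11SectFReg165Assembly
import Summits.QuantumFields.YangMills.Theorems.BalabanUVNodesN07AtRecordCarriersZ

/-!
# BalabanUVNodes ∕ N07 ([B11], `Dag.B11_main`) AT NODE 00's RECORDS — the knit at the [B11] bundle of record `Z11OfRecord F N ζ` from Proposition 7 with its displayed
# Sect. F binder `∀ i, B11SectFAssembly.Leaves (famXOfRecord F N ζ i) …` (dag-n07-a: `BalabanUVNodesN07AtRecord11` §3, p450629) REPLACED by the finer located displays of
# the printed proof of Sect. F pp. 300–304 at NODE 00's objects (`B11SectFReg165Assembly.ChainLeaves` ∕ `UnitLeaves`, p450655 ∕ p451731) — BY NAME through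
# `B11SectFReg165Assembly.leaves_of_chain_unit`, `B11SectFAssembly.thm1Printed_of_prop7_leaves` and `BalabanUVNodesN07AtRecordCarriersZ.laws_famXOfRecord`

Track A of `YM-PLAN.md` (cell `pub-ymgap`, HUMAN RULING D-0062), node **N07** = [Balaban1985Variational] Thm 1 p. 279 + Props 2–9 pp. 281–309; seat `pub-ymgap-dag-n07-c`
(generation 0; director R134 fan-out, strategy s1 = the first missing link of Sect. F: the leaf `Leaves.reg165` — (152) ∧ (165) on □, p. 304 — and its Δ₀ twin `Leaves.reg165_unit`,
both DERIVED in `Literature/…/B11SectFReg165Assembly.lean` from the located displays (152)–(153) [6] Thm 2 at the pair (U′_k, 1), (157) Sect. B change of variables, (158), (159),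
(46)∕(117) norms of H and G̃, (55), Prop. 4 (98), (161)₁ the H-kernel bound, (160), (155), the geometry (144)∕(148), (162)–(163), with the numerics by name from r08's
`B11Eq161HBChain`).  THIS FILE is the record-level consumer the n07-a lineage named at its close (INBOX «s1 → the `Leaves` fields at `famXOfRecord`»): the bundle-level sentences
of `BalabanUVNodesN07AtRecord11` §3 (`thm1Printed_Z11OfRecord_of_prop7_leaves`, `b11Leaf_Z11OfRecord_of_prop7_leaves` — themselves `B11SectFAssembly.thm1Printed_of_prop7_leaves` ∕
`prop8Printed_of_leaves` ∕ `sectFPrinted_of_leaves` over `laws_famXOfRecord`) re-derived by the SAME one-line compositions with the `Leaves` binder supplied by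
`leaves_of_chain_unit`, and the end-to-end ∃-sentence at the cumulative carrier pin `IsRecordOfRecord₁₀CB10YZ` (`BalabanUVNodesN07AtRecordCarriersZ.exists_record₁₀CB10YZ_b11_main_iff_leaf`,
p433511); the four-pin Stage-11 twin is VERBATIM `BalabanUVNodesN07AtRecord11.exists_record₁₁CB10YZW_b11_main_iff_leaf` (p450629) composed with `b11Leaf_Z11OfRecord_of_prop7_chain`
below (the bundle `Z11OfRecord F N ζ` is key-independent).  THEOREMS ONLY (0 `def`, 0 `sorry`, standard axioms); COUNT-NEUTRAL; `--supports stmt-QuantumFields-19674` (K1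
`StabilityBAtRecordR11e`, director LINE №68).  Nothing restated: `Record10Carriers`∕`CarriersZ` (g30∕g31), `B11SectFAssembly` (r08), `B11SectFReg165Assembly` (this seat),
`BalabanUVNodesN07AtRecordCarriersZ` (n07-a g3) are used by name.

WHAT CHANGES IN THE PIN LIST.  In the n07-a sentences the Sect. F input was ONE display per member i : `ZIdx` — `Leaves (famXOfRecord F N ζ i) (Dc i) d L B₁ B₂ B₃ K R₁M₁ c₁ a₃ a₄`
(six located fields: (152)∧(165) on □, (165) on Δ₀, [6] (1.141)–(1.142), locality of (2), [6] (1.36), side data).  Here the two (165)-fields are no longer inputs; displayed instead,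
per member: per-cube analytic data `X i : ChainData …` (seminormed groups of fields on □̃ and of currents, the A of (152)∕(159), A₁, HB, the operators H, D, G̃, W = (δ∕δA)V₁ at
the background 1, the □-seminorms, ℭ_k(□) with near∕far parts over a multiscale geometry `g i`, |B(c)|, |y₂ − y|) with `ChainLeaves` (the displays listed above, at the leaf's own
`ζ.B₁`, `ζ.B₃`, `ζ.c₁`), the Δ₀ data `Y i : UnitData …` with `UnitLeaves`, the three remaining located leaves `dev1142` ∕ `inU_local` ∕ `holder136` VERBATIM, and `(g i).L = L`
(the geometry's scale factor is the paper's L); the constant K of (165)–(166) is now the explicit `K165 d L B₀ ζ.B₁ C₂ C₄ R₁M₁ = B₀(C₄ + 4C₂)(36dL²B₁R₁M₁)²`.  So at NODE 00's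
objects the Sect. F inputs of N07 read BY NAME: [6] Thm 2 at the record's class cubes ((152) sup part `h152` + Hölder part `holder136`; the N05 [B8] in-edge), the H-kernel bound
(161)₁ (`h161` ∕ `h161_unit`; [3]∕[5], the N02∕N06 propagator in-edges), (160) and (155) (`h160`, `h155`; lattice-level rows `B11Eq160BondField`, `B11Eq155BlockLog` to be
instantiated at objects), the Sect. B–E structure (157)–(159) (`h157`, `h158`, `h46`, `hGt`, `h55`, `h98`), the geometry (144)∕(148)∕(162)–(163), [6] (1.141)–(1.142) (`dev1142`;
lattice-level rows `B8Ineq1141SectG`), locality of (2) (`inU_local`).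
* §1 `leaves_famXOfRecord_of_chain` — the `Leaves` display of member i from its chain displays (`leaves_of_chain_unit` + the rewrite `(g i).L = L`).
* §2 **`thm1Printed_Z11OfRecord_of_prop7_chain`**, **`b11Leaf_Z11OfRecord_of_prop7_chain`** (the bundle-level sentences), `exists_record₁₀CB10YZ_b11_main_of_prop7_chain` (the
  end-to-end ∃-sentence at the cumulative carrier pin; its ₁₁CB10YZW twin = p450629's `exists_record₁₁CB10YZW_b11_main_iff_leaf` ∘ `b11Leaf_Z11OfRecord_of_prop7_chain`).
HONEST FRAMING.  [B11]'s Theorem 1 is proved NOWHERE in the tree for `k ≥ 1`; every field of `ChainLeaves` ∕ `UnitLeaves`, the three remaining leaves, Props 2–7, 9 and the two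
residual laws `hcrit ∕ hloc` are DISPLAYED, never asserted; ONE located input beyond print is flagged in `B11SectFReg165Assembly` §3 (`UnitLeaves.sep_unit`, the separation from the
CENTRAL unit cube of a class cube of size M > R₁M₁); `Dag.B11_main` is closed ONLY from displayed slots at an ∃-record with junk in-edges; N07 NOT discharged (5∕27 untouched);
G-B11-02 (repaired (166′) inside `prop8Printed_of_leaves`), G-B11-F3 (`holder136` at β₀ = 1) stand; one finite four-torus programme at fixed `ε` — NOT ℝ⁴, NOT infinite volume, NOT OS,
NOT a mass gap, NOT Clay.  Restate-immune (no `def`).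
-/

noncomputable section

namespace Summit.QuantumFields.YangMills.BalabanUVNodes.N07SectFChainAtRecord

open Literature.MathematicalPhysics.QuantumFieldTheory.Balaban1983to89
open Literature.MathematicalPhysics.QuantumFieldTheory.Balaban1983to89.T4Continuum (T4Family FiniteEpsData)
open Literature.MathematicalPhysics.QuantumFieldTheory.Balaban1983to89.DagBinding
open Literature.MathematicalPhysics.QuantumFieldTheory.Balaban1983to89.Node00
open Literature.MathematicalPhysics.QuantumFieldTheory.Balaban1983to89.B11SectFAssembly (CubeData Leaves tinv thm1Printed_of_prop7_leaves prop8Printed_of_leaves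
  sectFPrinted_of_leaves)
open Literature.MathematicalPhysics.QuantumFieldTheory.Balaban1983to89.B11SectFReg165Assembly
open Literature.MathematicalPhysics.QuantumFieldTheory.Balaban1983to89.B11Holder9 (HolderClause)
open YMDAG.UVSplit (RecordPred Datum AtRecord S_N07)
open Summit.QuantumFields.YangMills.BalabanUVNodes.N07AtRecordCarriersZ (laws_famXOfRecord exists_record₁₀CB10YZ_b11_main_iff_leaf)
open scoped Matrix.Norms.L2Operator

variable {N : ℕ} [NeZero N] {F : T4Family}

/-! ## §1 The `Leaves` display of a member of the family of record from its chain displays -/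

/-- **THE SECT. F LEAVES OF MEMBER i OF THE FAMILY OF RECORD FROM ITS CHAIN DISPLAYS** (`B11SectFReg165Assembly.leaves_of_chain_unit` BY NAME, then the scale letter of the member's
geometry identified with the paper's L): from `ChainLeaves` ((152)–(153), (157), (158), (46)∕(117), (55), (98), (161)₁, (160), (155), (144)∕(148), (162)–(163) at the per-cube data `X`),
`UnitLeaves` (the Δ₀(□) twins at `Y`, `Dc`), and the three remaining located leaves — [6] (1.141)–(1.142) at the background 1 (`dev1142`), locality and gauge invariance of (2) (`inU_local`),
[6] Thm 2 (1.36) (`holder136`) — the display `B11SectFAssembly.Leaves` of that member with K := `K165 d L B₀ B₁ C₂ C₄ R₁M₁`; BOTH (165)-leaves inside it are DERIVED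
(`reg165_of_chain`, `reg165_unit_of_chain`). [cite: Balaban1985Variational, Sect. F (144)–(169) pp.300–305] -/
theorem leaves_famXOfRecord_of_chain (ζ : ResidZ F N) (i : ZIdx) (Dc : CubeData (famXOfRecord F N ζ i))
    {E Fc : (famXOfRecord F N ζ i).Cube → Type} [∀ c, SeminormedAddCommGroup (E c)] [∀ c, SeminormedAddCommGroup (Fc c)] {g : B6.Geometry} {d : ℕ}
    {X : ChainData (famXOfRecord F N ζ i) E Fc g d} {Y : UnitData (famXOfRecord F N ζ i) E g}
    {δ₀ B₀ B₁ B₂ B₃ C₂ C₄ S R₁M₁ c₁ a₃ a₄ L : ℝ} (hgL : g.L = L)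
    (hX : ChainLeaves (famXOfRecord F N ζ i) X δ₀ B₀ B₁ B₃ C₂ C₄ S R₁M₁ c₁ a₃ a₄) (hY : UnitLeaves (famXOfRecord F N ζ i) X Dc Y δ₀ B₀ c₁)
    (dev1142 : ∀ (U : (famXOfRecord F N ζ i).Cfg) (c : (famXOfRecord F N ζ i).Cube) (e : ℝ), (famXOfRecord F N ζ i).Gauged U c → 0 < e → e ≤ 1 →
      Dc.normA0 U c < e * tinv (famXOfRecord F N ζ i) c ^ 1 → Dc.normGradA0 U c < e * tinv (famXOfRecord F N ζ i) c ^ 2 →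
      Dc.normLapA0 U c < e * tinv (famXOfRecord F N ζ i) c ^ 3 →
      Dc.plaqDev U c < 2 * e + 8 * e ^ 2 ∧ Dc.dstarDev U c < e + 36 * (d : ℝ) * e ^ 2 + 50 * (d : ℝ) * e ^ 3)
    (inU_local : ∀ (r : ℝ) (U : (famXOfRecord F N ζ i).Cfg), 0 < r →
      (∀ c : (famXOfRecord F N ζ i).Cube, (famXOfRecord F N ζ i).sizeM c = R₁M₁ → Dc.plaqDev U c < r ∧ Dc.dstarDev U c < r) →
      (famXOfRecord F N ζ i).InU r U)
    (holder136 : ∀ (ε₀ ε₁ : ℝ) (V : (famXOfRecord F N ζ i).Bdry) (U : (famXOfRecord F N ζ i).Cfg) (c : (famXOfRecord F N ζ i).Cube), 0 < ε₁ →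
      (famXOfRecord F N ζ i).Reg7 ε₁ V → (famXOfRecord F N ζ i).InU ε₀ U → (famXOfRecord F N ζ i).InB V U → (famXOfRecord F N ζ i).IsCritical V U →
      9 * (d : ℝ) * L ^ 2 * (famXOfRecord F N ζ i).sizeM c * ε₀ ≤ c₁ →
      HolderClause ((famXOfRecord F N ζ i).holderA U c) 1 (B₂ * (ε₀ + (9 * (d : ℝ) * L ^ 2 * (famXOfRecord F N ζ i).sizeM c * ε₀ - ε₀)))
        (tinv (famXOfRecord F N ζ i) c)) :
    Leaves (famXOfRecord F N ζ i) Dc (d : ℝ) L B₁ B₂ B₃ (K165 d L B₀ B₁ C₂ C₄ R₁M₁) R₁M₁ c₁ a₃ a₄ := by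
  subst hgL
  exact leaves_of_chain_unit hX hY dev1142 inU_local holder136

/-! ## §2 The bundle-level sentences and the end-to-end ∃-sentence with the Sect. F binder replaced by the chain displays -/

section Knit

variable (ζ : ResidZ F N) (Dc : ∀ i : ZIdx, CubeData (famXOfRecord F N ζ i))
  {E Fc : (i : ZIdx) → (famXOfRecord F N ζ i).Cube → Type} [∀ i c, SeminormedAddCommGroup (E i c)] [∀ i c, SeminormedAddCommGroup (Fc i c)]
  {g : ZIdx → B6.Geometry} {d : ℕ} {X : ∀ i : ZIdx, ChainData (famXOfRecord F N ζ i) (E i) (Fc i) (g i) d}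
  {Y : ∀ i : ZIdx, UnitData (famXOfRecord F N ζ i) (E i) (g i)} {δ₀ B₀ B₂ C₂ C₄ S R₁M₁ a₃ a₄ L : ℝ}

/-- **THEOREM 1 OVER THE THEOREM-1 FAMILY OF RECORD ⇐ PROPOSITION 7 ∧ THE CHAIN DISPLAYS OF SECT. F** (`B11SectFAssembly.thm1Printed_of_prop7_leaves` BY NAME over the
carrier dictionary `laws_famXOfRecord` — the composition of `BalabanUVNodesN07AtRecord11.thm1Printed_Z11OfRecord_of_prop7_leaves` —, its binder `hLv` supplied member by member by
`leaves_famXOfRecord_of_chain`): from `B11.Prop7Printed ζ.B₃ ζ.C₁` over `famXOfRecord F N ζ`, per member the chain displays `ChainLeaves` ∕ `UnitLeaves` at per-cube data (at the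
leaf's own `ζ.B₁`, `ζ.B₃`, `ζ.c₁`), the three remaining located leaves, `(g i).L = L`, the sign data and the two residual dictionary clauses `hcrit` ∕ `hloc` of p433511 (D-B11-2) —
Theorem 1 over `(Z11OfRecord F N ζ).famV`. [cite: Balaban1985Variational, Thm 1 p.279, Prop. 7 p.299, Prop. 8 p.304, Sect. F (144)–(169) pp.300–305] -/
theorem thm1Printed_Z11OfRecord_of_prop7_chain (hgL : ∀ i, (g i).L = L)
    (hX : ∀ i, ChainLeaves (famXOfRecord F N ζ i) (X i) δ₀ B₀ ζ.B₁ ζ.B₃ C₂ C₄ S R₁M₁ ζ.c₁ a₃ a₄)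
    (hY : ∀ i, UnitLeaves (famXOfRecord F N ζ i) (X i) (Dc i) (Y i) δ₀ B₀ ζ.c₁)
    (dev1142 : ∀ (i : ZIdx) (U : (famXOfRecord F N ζ i).Cfg) (c : (famXOfRecord F N ζ i).Cube) (e : ℝ), (famXOfRecord F N ζ i).Gauged U c → 0 < e → e ≤ 1 →
      (Dc i).normA0 U c < e * tinv (famXOfRecord F N ζ i) c ^ 1 → (Dc i).normGradA0 U c < e * tinv (famXOfRecord F N ζ i) c ^ 2 →
      (Dc i).normLapA0 U c < e * tinv (famXOfRecord F N ζ i) c ^ 3 →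
      (Dc i).plaqDev U c < 2 * e + 8 * e ^ 2 ∧ (Dc i).dstarDev U c < e + 36 * (d : ℝ) * e ^ 2 + 50 * (d : ℝ) * e ^ 3)
    (inU_local : ∀ (i : ZIdx) (r : ℝ) (U : (famXOfRecord F N ζ i).Cfg), 0 < r →
      (∀ c : (famXOfRecord F N ζ i).Cube, (famXOfRecord F N ζ i).sizeM c = R₁M₁ → (Dc i).plaqDev U c < r ∧ (Dc i).dstarDev U c < r) →
      (famXOfRecord F N ζ i).InU r U)
    (holder136 : ∀ (i : ZIdx) (ε₀ ε₁ : ℝ) (V : (famXOfRecord F N ζ i).Bdry) (U : (famXOfRecord F N ζ i).Cfg) (c : (famXOfRecord F N ζ i).Cube),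
      0 < ε₁ → (famXOfRecord F N ζ i).Reg7 ε₁ V → (famXOfRecord F N ζ i).InU ε₀ U → (famXOfRecord F N ζ i).InB V U →
      (famXOfRecord F N ζ i).IsCritical V U → 9 * (d : ℝ) * L ^ 2 * (famXOfRecord F N ζ i).sizeM c * ε₀ ≤ ζ.c₁ →
      HolderClause ((famXOfRecord F N ζ i).holderA U c) 1 (B₂ * (ε₀ + (9 * (d : ℝ) * L ^ 2 * (famXOfRecord F N ζ i).sizeM c * ε₀ - ε₀)))
        (tinv (famXOfRecord F N ζ i) c))
    (hd : 1 ≤ d) (hL : 0 < L) (hB₀ : 0 < B₀) (hB₂ : 0 < B₂) (hC : 0 < C₄ + 4 * C₂) (hR : 1 ≤ R₁M₁) (ha₃ : 0 < a₃) (ha₄ : 0 < a₄)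
    (hB₁ : 0 < ζ.B₁) (hB₃ : 0 < ζ.B₃) (hC₁ : 0 < ζ.C₁) (hc₁ : 0 < ζ.c₁)
    (hcrit : ∀ (i : ZIdx) (e : ℝ) (V : GaugeField (F.P i.K) i.k (SU N)) (U : GaugeField (F.P i.K) 0 (SU N)),
      IsBackground (avOfRecord F N i.K) {U | InUkClassB11 F N i.K i.k e U} i.k V U → ζ.IsCrit i V U)
    (hloc : ∀ (i : ZIdx) (e e' : ℝ) (V : GaugeField (F.P i.K) i.k (SU N)) (U : GaugeField (F.P i.K) 0 (SU N)), e' < e →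
      IsBackground (avOfRecord F N i.K) {U | InUkClassB11 F N i.K i.k e' U} i.k V U → IsBackground (avOfRecord F N i.K) {U | InUkClassB11 F N i.K i.k e U} i.k V U)
    (p7 : B11.Prop7Printed ζ.B₃ ζ.C₁ (famXOfRecord F N ζ)) : B11.Thm1Printed (Z11OfRecord F N ζ).famV :=
  have hd' : (1 : ℝ) ≤ d := by exact_mod_cast hd
  thm1Printed_of_prop7_leaves (famXOfRecord F N ζ) Dc
    (fun i => leaves_famXOfRecord_of_chain ζ i (Dc i) (hgL i) (hX i) (hY i) (dev1142 i) (inU_local i) (holder136 i))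
    hd' hL hB₁ hB₂ hB₃ (K165_pos hd hL hB₀ hB₁ hC (by linarith)) hR hc₁ ha₃ ha₄ hC₁ (fun i => laws_famXOfRecord ζ i (hcrit i) (hloc i)) p7

/-- **THE [B11] LEAF AT THE BUNDLE OF RECORD FROM PROPS 2–7, 9 AND THE CHAIN DISPLAYS OF SECT. F** (the record literal of
`BalabanUVNodesN07AtRecord11.b11Leaf_Z11OfRecord_of_prop7_leaves` with `hLv` from `leaves_famXOfRecord_of_chain`: `t1` by `thm1Printed_Z11OfRecord_of_prop7_chain`, `p8` by
`B11SectFAssembly.prop8Printed_of_leaves`, `sF` by `B11SectFAssembly.sectFPrinted_of_leaves`): p433511's nine-part pin list with Proposition 8, the Sect. F conclusion AND the two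
(165)-leaves no longer inputs.  Displayed: Props 2–6 over `ζ.famLG`, Prop. 7 over `famXOfRecord F N ζ`, Prop. 9 over `ζ.famAn`, the chain displays, the three remaining leaves,
`(g i).L = L`, `hcrit ∕ hloc`, sign conditions. [cite: Balaban1985Variational, Thm 1 p.279, Props 2–9 pp.281–309, Sect. F (144)–(169) pp.300–305] -/
theorem b11Leaf_Z11OfRecord_of_prop7_chain (hgL : ∀ i, (g i).L = L)
    (hX : ∀ i, ChainLeaves (famXOfRecord F N ζ i) (X i) δ₀ B₀ ζ.B₁ ζ.B₃ C₂ C₄ S R₁M₁ ζ.c₁ a₃ a₄)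
    (hY : ∀ i, UnitLeaves (famXOfRecord F N ζ i) (X i) (Dc i) (Y i) δ₀ B₀ ζ.c₁)
    (dev1142 : ∀ (i : ZIdx) (U : (famXOfRecord F N ζ i).Cfg) (c : (famXOfRecord F N ζ i).Cube) (e : ℝ), (famXOfRecord F N ζ i).Gauged U c → 0 < e → e ≤ 1 →
      (Dc i).normA0 U c < e * tinv (famXOfRecord F N ζ i) c ^ 1 → (Dc i).normGradA0 U c < e * tinv (famXOfRecord F N ζ i) c ^ 2 →
      (Dc i).normLapA0 U c < e * tinv (famXOfRecord F N ζ i) c ^ 3 →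
      (Dc i).plaqDev U c < 2 * e + 8 * e ^ 2 ∧ (Dc i).dstarDev U c < e + 36 * (d : ℝ) * e ^ 2 + 50 * (d : ℝ) * e ^ 3)
    (inU_local : ∀ (i : ZIdx) (r : ℝ) (U : (famXOfRecord F N ζ i).Cfg), 0 < r →
      (∀ c : (famXOfRecord F N ζ i).Cube, (famXOfRecord F N ζ i).sizeM c = R₁M₁ → (Dc i).plaqDev U c < r ∧ (Dc i).dstarDev U c < r) →
      (famXOfRecord F N ζ i).InU r U)
    (holder136 : ∀ (i : ZIdx) (ε₀ ε₁ : ℝ) (V : (famXOfRecord F N ζ i).Bdry) (U : (famXOfRecord F N ζ i).Cfg) (c : (famXOfRecord F N ζ i).Cube),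
      0 < ε₁ → (famXOfRecord F N ζ i).Reg7 ε₁ V → (famXOfRecord F N ζ i).InU ε₀ U → (famXOfRecord F N ζ i).InB V U →
      (famXOfRecord F N ζ i).IsCritical V U → 9 * (d : ℝ) * L ^ 2 * (famXOfRecord F N ζ i).sizeM c * ε₀ ≤ ζ.c₁ →
      HolderClause ((famXOfRecord F N ζ i).holderA U c) 1 (B₂ * (ε₀ + (9 * (d : ℝ) * L ^ 2 * (famXOfRecord F N ζ i).sizeM c * ε₀ - ε₀)))
        (tinv (famXOfRecord F N ζ i) c))
    (hd : 1 ≤ d) (hL : 0 < L) (hB₀ : 0 < B₀) (hB₂ : 0 < B₂) (hC : 0 < C₄ + 4 * C₂) (hR : 1 ≤ R₁M₁) (ha₃ : 0 < a₃) (ha₄ : 0 < a₄)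
    (hB₁ : 0 < ζ.B₁) (hB₃ : 0 < ζ.B₃) (hC₁ : 0 < ζ.C₁) (hc₁ : 0 < ζ.c₁)
    (hcrit : ∀ (i : ZIdx) (e : ℝ) (V : GaugeField (F.P i.K) i.k (SU N)) (U : GaugeField (F.P i.K) 0 (SU N)),
      IsBackground (avOfRecord F N i.K) {U | InUkClassB11 F N i.K i.k e U} i.k V U → ζ.IsCrit i V U)
    (hloc : ∀ (i : ZIdx) (e e' : ℝ) (V : GaugeField (F.P i.K) i.k (SU N)) (U : GaugeField (F.P i.K) 0 (SU N)), e' < e →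
      IsBackground (avOfRecord F N i.K) {U | InUkClassB11 F N i.K i.k e' U} i.k V U → IsBackground (avOfRecord F N i.K) {U | InUkClassB11 F N i.K i.k e U} i.k V U)
    (p2 : B11.Prop2Printed ζ.B₁ ζ.B₃ ζ.C₁ ζ.c₁ ζ.famLG) (p3 : B11.Prop3Printed ζ.C₁ ζ.B₃ ζ.C₂ ζ.C₃ ζ.B₀ ζ.c1h ζ.c₄ ζ.δ₀ ζ.famLG)
    (p4 : B11.Prop4Printed ζ.C₁ ζ.B₃ ζ.famLG) (p5 : B11.Prop5Printed ζ.B₁ ζ.B₃ ζ.C₁ ζ.famLG) (p6 : B11.Prop6Printed ζ.B₀ ζ.B₃ ζ.C₁ ζ.famLG)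
    (p7 : B11.Prop7Printed ζ.B₃ ζ.C₁ (famXOfRecord F N ζ)) (p9 : B11.Prop9Printed ζ.B₅ ζ.C₁ ζ.β₀ ζ.δ₀ ζ.famAn) :
    B11Leaf (Z11OfRecord F N ζ) :=
  have hd' : (1 : ℝ) ≤ d := by exact_mod_cast hd
  have hK : 0 < K165 d L B₀ ζ.B₁ C₂ C₄ R₁M₁ := K165_pos hd hL hB₀ hB₁ hC (by linarith)
  have hLv : ∀ i, Leaves (famXOfRecord F N ζ i) (Dc i) (d : ℝ) L ζ.B₁ B₂ ζ.B₃ (K165 d L B₀ ζ.B₁ C₂ C₄ R₁M₁) R₁M₁ ζ.c₁ a₃ a₄ :=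
    fun i => leaves_famXOfRecord_of_chain ζ i (Dc i) (hgL i) (hX i) (hY i) (dev1142 i) (inU_local i) (holder136 i)
  have laws : ∀ i, (famXOfRecord F N ζ i).Laws := fun i => laws_famXOfRecord ζ i (hcrit i) (hloc i)
  { t1 := thm1Printed_Z11OfRecord_of_prop7_chain ζ Dc hgL hX hY dev1142 inU_local holder136 hd hL hB₀ hB₂ hC hR ha₃ ha₄ hB₁ hB₃ hC₁ hc₁
      hcrit hloc p7
    p2 := p2, p3 := p3, p4 := p4, p5 := p5, p6 := p6, p7 := p7
    p8 := prop8Printed_of_leaves (famXOfRecord F N ζ) Dc hLv hd' hL hB₁ hB₃ hK (by linarith) hc₁ ha₃ ha₄ fun i => (laws i).1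
    sF := sectFPrinted_of_leaves (famXOfRecord F N ζ) Dc hLv (by linarith) hL hB₁ hB₂ hB₃ hK hR hc₁ ha₃ ha₄
    p9 := p9 }

/-- **THE CONSUMER AT THE CUMULATIVE CARRIER PIN, END TO END, WITH THE CHAIN DISPLAYS**: Props 2–7, 9 + the chain displays of Sect. F + the three remaining located leaves +
the two residual laws at a residual [B11] layer `ζ` ⇒ N07 HOLDS at every run of a ₁₀CB10YZ record over `datumOfRecord₁₀ θ h`, every admissible `θ` with its Stage-10 provisos and
`γ > 0` (`BalabanUVNodesN07AtRecordCarriersZ.exists_record₁₀CB10YZ_b11_main_iff_leaf` + `b11Leaf_Z11OfRecord_of_prop7_chain`; the four-pin Stage-11 twin is the same line with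
p450629's `exists_record₁₁CB10YZW_b11_main_iff_leaf`).  NOT a discharge (∃-record, junk in-edges): it certifies that the displayed inputs CLOSE the node's own leaf at NODE 00's
objects through print's architecture, one storey below `…_of_prop7_leaves`. [cite: Balaban1985Variational, Thm 1 p.279, Props 2–9 pp.281–309, Sect. F pp.300–305] -/
theorem exists_record₁₀CB10YZ_b11_main_of_prop7_chain (θ : Stage9Params F N) (h : θ.Provisos₁₀) (hθ : θ.Admissible) (hγ : 0 < θ.γ) (Mstar : ℕ)
    (hgL : ∀ i, (g i).L = L)
    (hX : ∀ i, ChainLeaves (famXOfRecord F N ζ i) (X i) δ₀ B₀ ζ.B₁ ζ.B₃ C₂ C₄ S R₁M₁ ζ.c₁ a₃ a₄)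
    (hY : ∀ i, UnitLeaves (famXOfRecord F N ζ i) (X i) (Dc i) (Y i) δ₀ B₀ ζ.c₁)
    (dev1142 : ∀ (i : ZIdx) (U : (famXOfRecord F N ζ i).Cfg) (c : (famXOfRecord F N ζ i).Cube) (e : ℝ), (famXOfRecord F N ζ i).Gauged U c → 0 < e → e ≤ 1 →
      (Dc i).normA0 U c < e * tinv (famXOfRecord F N ζ i) c ^ 1 → (Dc i).normGradA0 U c < e * tinv (famXOfRecord F N ζ i) c ^ 2 →
      (Dc i).normLapA0 U c < e * tinv (famXOfRecord F N ζ i) c ^ 3 →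
      (Dc i).plaqDev U c < 2 * e + 8 * e ^ 2 ∧ (Dc i).dstarDev U c < e + 36 * (d : ℝ) * e ^ 2 + 50 * (d : ℝ) * e ^ 3)
    (inU_local : ∀ (i : ZIdx) (r : ℝ) (U : (famXOfRecord F N ζ i).Cfg), 0 < r →
      (∀ c : (famXOfRecord F N ζ i).Cube, (famXOfRecord F N ζ i).sizeM c = R₁M₁ → (Dc i).plaqDev U c < r ∧ (Dc i).dstarDev U c < r) →
      (famXOfRecord F N ζ i).InU r U)
    (holder136 : ∀ (i : ZIdx) (ε₀ ε₁ : ℝ) (V : (famXOfRecord F N ζ i).Bdry) (U : (famXOfRecord F N ζ i).Cfg) (c : (famXOfRecord F N ζ i).Cube),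
      0 < ε₁ → (famXOfRecord F N ζ i).Reg7 ε₁ V → (famXOfRecord F N ζ i).InU ε₀ U → (famXOfRecord F N ζ i).InB V U →
      (famXOfRecord F N ζ i).IsCritical V U → 9 * (d : ℝ) * L ^ 2 * (famXOfRecord F N ζ i).sizeM c * ε₀ ≤ ζ.c₁ →
      HolderClause ((famXOfRecord F N ζ i).holderA U c) 1 (B₂ * (ε₀ + (9 * (d : ℝ) * L ^ 2 * (famXOfRecord F N ζ i).sizeM c * ε₀ - ε₀)))
        (tinv (famXOfRecord F N ζ i) c))
    (hd : 1 ≤ d) (hL : 0 < L) (hB₀ : 0 < B₀) (hB₂ : 0 < B₂) (hC : 0 < C₄ + 4 * C₂) (hR : 1 ≤ R₁M₁) (ha₃ : 0 < a₃) (ha₄ : 0 < a₄)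
    (hB₁ : 0 < ζ.B₁) (hB₃ : 0 < ζ.B₃) (hC₁ : 0 < ζ.C₁) (hc₁ : 0 < ζ.c₁)
    (hcrit : ∀ (i : ZIdx) (e : ℝ) (V : GaugeField (F.P i.K) i.k (SU N)) (U : GaugeField (F.P i.K) 0 (SU N)),
      IsBackground (avOfRecord F N i.K) {U | InUkClassB11 F N i.K i.k e U} i.k V U → ζ.IsCrit i V U)
    (hloc : ∀ (i : ZIdx) (e e' : ℝ) (V : GaugeField (F.P i.K) i.k (SU N)) (U : GaugeField (F.P i.K) 0 (SU N)), e' < e →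
      IsBackground (avOfRecord F N i.K) {U | InUkClassB11 F N i.K i.k e' U} i.k V U → IsBackground (avOfRecord F N i.K) {U | InUkClassB11 F N i.K i.k e U} i.k V U)
    (p2 : B11.Prop2Printed ζ.B₁ ζ.B₃ ζ.C₁ ζ.c₁ ζ.famLG) (p3 : B11.Prop3Printed ζ.C₁ ζ.B₃ ζ.C₂ ζ.C₃ ζ.B₀ ζ.c1h ζ.c₄ ζ.δ₀ ζ.famLG)
    (p4 : B11.Prop4Printed ζ.C₁ ζ.B₃ ζ.famLG) (p5 : B11.Prop5Printed ζ.B₁ ζ.B₃ ζ.C₁ ζ.famLG) (p6 : B11.Prop6Printed ζ.B₀ ζ.B₃ ζ.C₁ ζ.famLG)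
    (p7 : B11.Prop7Printed ζ.B₃ ζ.C₁ (famXOfRecord F N ζ)) (p9 : B11.Prop9Printed ζ.B₅ ζ.C₁ ζ.β₀ ζ.δ₀ ζ.famAn) :
    ∃ w : WorldP, IsRecordOfRecord₁₀CB10YZ F N (datumOfRecord₁₀ F N θ h) w ∧ ∀ P : B12.RunParams, Dag.B11_main (leavesP w P) := by
  obtain ⟨w, hw, hl⟩ := exists_record₁₀CB10YZ_b11_main_iff_leaf θ h hθ hγ Mstar ζ
  exact ⟨w, hw, fun P => (hl P).2 (b11Leaf_Z11OfRecord_of_prop7_chain ζ Dc hgL hX hY dev1142 inU_local holder136 hd hL hB₀ hB₂ hC hR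
    ha₃ ha₄ hB₁ hB₃ hC₁ hc₁ hcrit hloc p2 p3 p4 p5 p6 p7 p9)⟩

end Knit

end Summit.QuantumFields.YangMills.BalabanUVNodes.N07SectFChainAtRecord
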